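import Mathlib
import Summits.MatrixMultiplication.MatrixMultiplication.Theses.LevelGradedCohnUmans
import Literature.Combinatorics.Additive.TripleProductProperty

/-!
# Sketch — crux-ideate stmt-MatrixMultiplication-14080 (LevelOneGL2Designs), ideator 3 (round 1)

First-lemma signatures for the idea cards `kummer-det-gluing` and `unital-substitute-srs`,
plus the precise statements of the necessary conditions recorded in the Negative notes
(moat inequality, fibre-volume bound).  Everything here only has to ELABORATE; proofs are
`sorry` except where a one-liner closes them.  Vocabulary is definitionally the crux's inlined
clauses at `m = 2`, `k = 1` (`levelOneGL2Designs_iff` is `Iff.rfl`).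
-/

set_option linter.dupNamespace false

namespace Summit.MatrixMultiplication.MatrixMultiplication.Cruxes.LevelOneGL2Designs.Ideator3

open scoped BigOperators
open Literature.Combinatorics.Additive (TripleProductProperty)

/-- `GL_2(𝔽_p)`. -/
abbrev GL2 (p : ℕ) : Type := Matrix.GeneralLinearGroup (Fin 2) (ZMod p)

/-- `M_2(𝔽_p)`. -/
abbrev Mat2 (p : ℕ) : Type := Matrix (Fin 2) (Fin 2) (ZMod p)

variable {p : ℕ} [Fact p.Prime]

/-- Level-one (Fourier rank ≤ 1) test functions on `GL_2(𝔽_p)`: the crux's test space `F_1`. -/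
def IsLevelOne (f : GL2 p → ℂ) : Prop :=
  ∃ c : Mat2 p → ℂ, (∀ M, 1 < M.rank → c M = 0) ∧
    ∀ g : GL2 p, f g = ∑ M : Mat2 p, c M * ZMod.stdAddChar (Matrix.trace (M * (g : Mat2 p)))

/-- Rank-1 separation of a triple — literally the crux's first clause. -/
def RankOneSep (X Y Z : Finset (GL2 p)) : Prop :=
  ∀ x₀ ∈ X, ∀ z₀ ∈ Z, ∃ c : Mat2 p → ℂ, (∀ M, 1 < M.rank → c M = 0) ∧
    ∀ x ∈ X, ∀ y ∈ Y, ∀ y' ∈ Y, ∀ z ∈ Z,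
      (∑ M : Mat2 p, c M * ZMod.stdAddChar (Matrix.trace (M * ((x⁻¹ * y * y'⁻¹ * z : GL2 p) : Mat2 p)))) =
        if x = x₀ ∧ y = y' ∧ z = z₀ then 1 else 0

/-- The crux restated with the named clause (definitional). -/
theorem levelOneGL2Designs_iff :
    Summit.MatrixMultiplication.MatrixMultiplication.Theses.LevelGradedCohnUmans.LevelOneGL2Designs ↔
      ∃ c : ℝ, 0 < c ∧ ∀ p₀ : ℕ, ∃ (p : ℕ) (_ : Fact p.Prime), p₀ ≤ p ∧
        ∃ X Y Z : Finset (GL2 p), RankOneSep X Y Z ∧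
          c * (p : ℝ) ^ (3 / 2 : ℝ) ≤ X.card ∧ c * (p : ℝ) ^ (3 / 2 : ℝ) ≤ Y.card ∧
            c * (p : ℝ) ^ (3 / 2 : ℝ) ≤ Z.card :=
  Iff.rfl

/-! ## Card `kummer-det-gluing`: first lemma (determinant gluing of a core TPP triple) -/

/-- The determinant of an element of `GL_2(𝔽_p)` as an element of `𝔽_p`. -/
def det2 (g : GL2 p) : ZMod p := Matrix.det (g : Mat2 p)

/-- Left translate of a core set by a torus set: `D ⋆ X₁ = {τ x : τ ∈ D, x ∈ X₁}`. -/
noncomputable def glue (D X₁ : Finset (GL2 p)) : Finset (GL2 p) :=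
  open Classical in (D ×ˢ X₁).image fun q => q.1 * q.2

theorem det2_mul (g h : GL2 p) : det2 (g * h) = det2 g * det2 h := by
  simp [det2, Matrix.det_mul]

theorem det2_one : det2 (1 : GL2 p) = 1 := by
  simp [det2]

theorem det2_ne_zero (g : GL2 p) : det2 g ≠ 0 := by
  intro h0
  have h1 : det2 g * det2 g⁻¹ = 1 := by rw [← det2_mul, mul_inv_cancel, det2_one]
  simp [h0] at h1

theorem det2_inv (g : GL2 p) : det2 g⁻¹ = (det2 g)⁻¹ := by
  have h1 : det2 g * det2 g⁻¹ = 1 := by rw [← det2_mul, mul_inv_cancel, det2_one]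
  exact (inv_eq_of_mul_eq_one_right h1).symm

/-- Conjugation preserves `det2`. -/
theorem det2_conj (τ g : GL2 p) : det2 (τ * g * τ⁻¹) = det2 g := by
  rw [det2_mul, det2_mul, det2_inv, mul_comm (det2 τ) (det2 g), mul_assoc,
    mul_inv_cancel₀ (det2_ne_zero τ), mul_one]

/-- **Determinant gluing (first lemma of `kummer-det-gluing`).**  Let `D, D'` be "determinant-
independent" torus sets (for the intended `D = diag(μ_m,1)`, `D' = diag(μ_{m'},1)` with
`gcd(m,m') = 1` the hypothesis `hdet` is `μ_m ∩ μ_{m'} = 1` plus injectivity of `det` on each),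
let the core sets `X₁, Z₁` have constant determinant and be stable under conjugation by `D`
resp. `D'`, and let `Y` have constant determinant.  Then the TPP of the core `(X₁, Y, Z₁)`
implies the TPP of the glued triple `(D ⋆ X₁, Y, D' ⋆ Z₁)` (tree convention, Cohn–Umans Def. 2.1).
The sizes multiply (`|D ⋆ X₁| = |D|·|X₁|`, `card_glue`), so a core of shape
`(p^{3/2}/m, p^{3/2}, p^{3/2}/m')` with `m m' = p − 1` yields the crux's shape `(p^{3/2})³` for the
TPP half.  PROVED below (kernel-checked). [this card] -/
theorem tpp_detGlue (D D' X₁ Y Z₁ : Finset (GL2 p))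
    (hdet : ∀ τ ∈ D, ∀ τ₀ ∈ D, ∀ τ' ∈ D', ∀ τ₀' ∈ D',
      det2 τ₀ * det2 τ' = det2 τ * det2 τ₀' → τ = τ₀ ∧ τ' = τ₀')
    (hX : ∃ a : ZMod p, ∀ x ∈ X₁, det2 x = a) (hZ : ∃ b : ZMod p, ∀ z ∈ Z₁, det2 z = b)
    (hY : ∃ e : ZMod p, ∀ y ∈ Y, det2 y = e)
    (hXconj : ∀ τ ∈ D, ∀ x ∈ X₁, τ * x * τ⁻¹ ∈ X₁)
    (hZconj : ∀ τ' ∈ D', ∀ z ∈ Z₁, τ' * z * τ'⁻¹ ∈ Z₁)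
    (hcore : TripleProductProperty X₁ Y Z₁) :
    TripleProductProperty (glue D X₁) Y (glue D' Z₁) := by
  classical
  intro s hs s' hs' t ht t' ht' u hu u' hu' h
  simp only [glue, Finset.mem_image, Finset.mem_product, Prod.exists] at hs hs' hu hu'
  obtain ⟨τ, x, ⟨hτ, hx⟩, rfl⟩ := hs
  obtain ⟨τ₀, x₀, ⟨hτ₀, hx₀⟩, rfl⟩ := hs'
  obtain ⟨σ, z, ⟨hσ, hz⟩, rfl⟩ := hu
  obtain ⟨σ₀, z₀, ⟨hσ₀, hz₀⟩, rfl⟩ := hu'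
  obtain ⟨a, ha⟩ := hX
  obtain ⟨b, hb⟩ := hZ
  obtain ⟨e, he⟩ := hY
  -- determinant bookkeeping: det τ₀ · det σ₀ = det τ · det σ
  have hd : det2 τ₀ * det2 σ₀ = det2 τ * det2 σ := by
    have hh := congrArg det2 h
    simp only [det2_mul, det2_inv, det2_one, ha x hx, ha x₀ hx₀, he t ht, he t' ht',
      hb z hz, hb z₀ hz₀] at hh
    have ha0 : a ≠ 0 := by rw [← ha x hx]; exact det2_ne_zero x
    have hb0 : b ≠ 0 := by rw [← hb z hz]; exact det2_ne_zero z
    have he0 : e ≠ 0 := by rw [← he t ht]; exact det2_ne_zero t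
    have hτ0 := det2_ne_zero τ₀
    have hσ0 := det2_ne_zero σ₀
    field_simp at hh
    linear_combination -hh
  obtain ⟨rfl, rfl⟩ := hdet τ hτ τ₀ hτ₀ σ₀ hσ₀ σ hσ hd
  -- transport the relation to the core triple by conjugation
  have key : (τ * x * τ⁻¹) * (τ * x₀ * τ⁻¹)⁻¹ * (t * t'⁻¹) *
      ((σ₀ * z * σ₀⁻¹) * (σ₀ * z₀ * σ₀⁻¹)⁻¹) = 1 := by
    rw [← h]; group
  obtain ⟨h1, h2, h3⟩ := hcore _ (hXconj τ hτ x hx) _ (hXconj τ hτ x₀ hx₀) t ht t' ht'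
    _ (hZconj σ₀ hσ₀ z hz) _ (hZconj σ₀ hσ₀ z₀ hz₀) key
  refine ⟨?_, h2, ?_⟩
  · simpa using (mul_right_cancel h1 : τ * x = τ * x₀)
  · simpa using (mul_right_cancel h3 : σ₀ * z = σ₀ * z₀)

/-- Size bookkeeping for the glued sets under determinant independence. [this card] -/
theorem card_glue (D X₁ : Finset (GL2 p))
    (hdet : ∀ τ ∈ D, ∀ τ₀ ∈ D, det2 τ = det2 τ₀ → τ = τ₀)
    (hX : ∃ a : ZMod p, a ≠ 0 ∧ ∀ x ∈ X₁, det2 x = a) :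
    (glue D X₁).card = D.card * X₁.card := by
  sorry

/-! ## Card `unital-substitute-srs`: first lemma (root-group core ⇔ strong representative system) -/

/-- Lower root group `U⁻ = {(1 0; c 1)}` as a `Finset`. -/
noncomputable def rootMinus (p : ℕ) [Fact p.Prime] : Finset (GL2 p) :=
  open Classical in Finset.univ.filter fun g : GL2 p =>
    (g : Mat2 p) 0 0 = 1 ∧ (g : Mat2 p) 0 1 = 0 ∧ (g : Mat2 p) 1 1 = 1

/-- Upper root group `U⁺ = {(1 b; 0 1)}` as a `Finset`. -/
noncomputable def rootPlus (p : ℕ) [Fact p.Prime] : Finset (GL2 p) :=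
  open Classical in Finset.univ.filter fun g : GL2 p =>
    (g : Mat2 p) 0 0 = 1 ∧ (g : Mat2 p) 1 0 = 0 ∧ (g : Mat2 p) 1 1 = 1

/-- **Root-group core ⇔ SRS (first lemma of `unital-substitute-srs`).**  For `Y ⊆ SL_2(𝔽_p)` the
triple `(U⁻, Y, U⁺)` has the TPP iff the `(1,1)`-entry of every non-trivial quotient `y y'⁻¹`
differs from `1`; writing `r(y)` = first row of `y` and `s(y) = (y₂₂, −y₂₁)`, this says
`⟨r(y), s(y')⟩ = 1 ⇔ y = y'`, i.e. `{(s(y), line ⟨r(y),·⟩ = 1)}_{y ∈ Y}` is a strong representative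
system (point–tangent flag system) in `AG(2,p)`, whose size is `≤ p√p + 1` (Illés–Szőnyi–Wettl)
with equality iff unital — the crux's `p^{3/2}` on the nose. [this card] -/
theorem tpp_rootGroups_iff_srs (Y : Finset (GL2 p)) (hY : ∀ y ∈ Y, det2 y = 1) :
    TripleProductProperty (rootMinus p) Y (rootPlus p) ↔
      ∀ y ∈ Y, ∀ y' ∈ Y, y ≠ y' → ((y * y'⁻¹ : GL2 p) : Mat2 p) 0 0 ≠ 1 := by
  sorry

/-! ## Necessary conditions recorded in the Negative notes (for the disprover / as design constraints) -/

/-- The set of NON-TARGET quadruple products ("garbage") `𝒩 = {x⁻¹ y y'⁻¹ z : y ≠ y'}`. -/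
noncomputable def garbage (X Y Z : Finset (GL2 p)) : Finset (GL2 p) :=
  open Classical in
  ((((X ×ˢ Y) ×ˢ Y) ×ˢ Z).filter fun q => q.1.1.2 ≠ q.1.2).image
    fun q => q.1.1.1⁻¹ * q.1.1.2 * q.1.2⁻¹ * q.2

/-- `W(p) = dim F_1|_{GL_2(𝔽_p)} = p³ + p² − 3p − 1` (verified exactly by kit j008119 for p = 3, 5
and by this seat's local computation for p = 5: rank 134). -/
def wallDim (p : ℕ) : ℕ := p ^ 3 + p ^ 2 - 3 * p - 1

/-- **MOAT INEQUALITY (claimed theorem, trace/uncertainty argument).**  If `(X, Y, Z)` is rank-1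
separated then the separators `f_t`, `t ∈ X⁻¹Z`, are `|X||Z|` linearly independent level-one
functions supported on `G ∖ 𝒩`; since the orthogonal projection onto `F_1` is bi-invariant with
constant diagonal `W/|G|`, `dim{f ∈ F_1 : supp f ⊆ Σ} ≤ |Σ|·W/|G|`, whence
`|X|·|Z|·|G| ≤ W · |G ∖ 𝒩|`: the garbage misses at least the fraction `|X||Z|/W` of the group. -/
def MoatInequality : Prop :=
  ∀ (p : ℕ) [Fact p.Prime] (X Y Z : Finset (GL2 p)), RankOneSep X Y Z →
    X.card * Z.card * Fintype.card (GL2 p) ≤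
      wallDim p * (Fintype.card (GL2 p) - (garbage X Y Z).card)

/-- **FIBRE VOLUME BOUND (claimed theorem: in-coset uncertainty `|C ∖ 𝒩| ≥ (2 − o(1))|T ∩ C|`
for every `SL_2`-coset `C`, plus Babai–Nikolov–Pyber mixing in `SL_2(𝔽_p)` with minimal degree
`(p−1)/2`).**  For a rank-1-separated triple and ANY three determinant values `a, e, b`, the
determinant fibres satisfy `|X_a|·|Y_e|·|Z_b| ≤ 2 p⁴` for `p ≥ 7` (exact form
`(|X_a||Y_e||Z_b|)² ≤ 2(p³−p)³(p+3)/(p−1)²`, asymptotically `√2 p⁴`): designs must spread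
over `≳ √p` determinant-fibre triples, and every design inside boundedly many `SL_2`-cosets has
volume `O(p⁴)` (the exponent-3 line). -/
def FibreVolumeBound : Prop :=
  ∀ (p : ℕ) [Fact p.Prime] (X Y Z : Finset (GL2 p)), RankOneSep X Y Z → 7 ≤ p →
    ∀ a e b : ZMod p,
      (open Classical in (X.filter fun x => det2 x = a).card) *
        (open Classical in (Y.filter fun y => det2 y = e).card) *
          (open Classical in (Z.filter fun z => det2 z = b).card) ≤ 2 * p ^ 4

end Summit.MatrixMultiplication.MatrixMultiplication.Cruxes.LevelOneGL2Designs.Ideator3
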